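import Literature.NumberTheory.GaloisRepresentations.IdeleBrauerReciprocityArchimedean
import Literature.NumberTheory.GaloisRepresentations.IdeleLocalInvariantsRestrictionArch
import Literature.NumberTheory.GaloisRepresentations.IdeleLocalInvariantsCanonical
import Literature.NumberTheory.GaloisRepresentations.IdelePlaceReadout
import HarnessLib

/-!
# The idèle local invariant at an INFINITE place read out through `π_v` — the archimedean twin of F7-dict (ii)
# (`inv_{w_v}(c) = 0 ↔ [pull_{(d ↦ d|_E, π_v)} c] = 0` for EVERY `c ∈ H²(Gal(E/F), J_E)`, and the value in `{0, ½}`;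
# Tate, C–F VII §7.3 Cor. 7.4 (b), §11.2; Milne *ADT* I Ex. 1.6 (c))

Topic `NumberTheory/GaloisRepresentations`; namespace `Literature.NumberTheory.GaloisRepresentations.IdeleCohomology`
(door-c5's idèle local invariants; `IdeleReadout`, `ArchHerbrand` opened).  Definitions with bodies (one `Rep` morphism,
two compatible pairs, one correcting element) and theorems; NO named fact, no `sorry`, no notation, no global instance — one
LOCAL instance attribute (`attribute [local instance] absoluteGaloisGroup_compactSpace`, the tree's theorem, needed to form
continuous `2`-cocycle classes, exactly as in `IdeleLocalInvariantReadout.lean`; no override); number fields in `Type`.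

THE DICTIONARY AT AN INFINITE PLACE, GENERAL CLASSES.  `IdeleLocalInvariantReadout.lean` (door-c5, finite places) proves
`localInvAt w_v c = inv_{F_v}[pull_{readoutPair} c]`; `IdeleBrauerReciprocityArchimedean.lean` (door-c6) proves the archimedean
dictionary for RELATIVE BRAUER classes only.  The pairing step (R4) of the presentation road to Milne I Thm. 4.10 (FINDING-door-c6-g17
§2 (e)) needs the archimedean dictionary for EVERY idèle class `c ∈ H²(Gal(E/F), J_E)`:

  `localInvInfAt w_v c = 0 ↔ [ (s, t) ↦ π_v (c(s|_E, t|_E)) ] = 0` in `H²(Γ_{F_v}, F̄_vˣ)`,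

where `π_v = ideleInfPlaceReadout v ιE : J_E → F̄_vˣ` is door-c5 g17's archimedean place readout (the `w_v`-component followed by
the distinguished embedding `archPlaceEmb : E_{w_v} → F̄_v`) and `s ↦ s|_E = galRestrictField F_v ιE s`.  Since
`localInvInfAt w_v c ∈ (1/n_v)ℤ/ℤ ⊆ {0, ½}` (`n_v = #Stab(w_v) ∈ {1, 2}`), the vanishing statement determines the value
(`eq_of_two_nsmul_eq_zero_of_iff`), and through THE canonical family at `v` (`LocalInvariants.canonical F n (inl v) =
archimedeanInvariantMap F n v`, injective at real `v`, zero at complex `v`) one gets the value form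
`localInvInf E v c = zmodToQmodZ n (canonical F n (inl v) x)` for every class `x ∈ H²(Γ_{F_v}, μₙ|)` that vanishes exactly when
`[pull c]` does (`localInvInf_H2π_eq_zmodToQmodZ_canonical_of_iff`).  Proof.  (1) Door-c5's archimedean Shapiro isomorphism on a
general class is `Hⁿ(archDecompIncl w, x ↦ x_{∞,w})` (`shapiroArch_infPlaceProj`, from `groupCohomologyArchUnitsRepIso_hom_eq`:
`Sh_w = Hⁿ(Stab(w) ↪ G, π_w)` and `IsoAut = Hⁿ(archDecompMulEquiv⁻¹, id)`), so `localInvInfAt w [b] = 0 ↔ [pull_{P_w} b] = 0` for the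
pair `P_w = (absUnitsPair F_v E_w) ∘ (archDecompIncl w, x ↦ x_{∞,w})` (`localInvInfAt_H2π_eq_zero_iff_pull`; `archLayerInv`, the Shapiro
isomorphisms and `unitsAbsInfTwo F_v E_w` are injective).  (2) At `w = w_v` the two `F_v`-embeddings `ι_{E_w}` (`embeddingToAbs`) and
`archPlaceEmb` of the normal `E_w` differ by `τ = g_w`, `g ∈ Stab(w)` (`exists_stabilizer_archPlaceEmb_eq`), hence the readout pair
`Q = (galRestrictField, π_v)` is CONJUGATE to `P_w` by `g` and conjugate pairs induce the same map on `H²`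
(`CompatiblePair.twoCocycleClass_pull_eq_of_conj`, Serre VII §5 Prop. 3).

## What is formalised (`F E : Type`, `[IsGalois F E]`, `v : InfinitePlace F`, `w₀ ∣ v`, `ιE : E →ₐ[F] F̄`)

* §1 `archIdelePlaceRepHom v w₀ : Res_{archDecompIncl} J_E ⟶ E_{w₀}ˣ` (`x ↦ x_{∞,w₀}`), **`shapiroArch_infPlaceProj`** (all degrees),
  `archIdelePair v w₀`, `archIdelePair_φ`, `embeddingToAbs_archIdelePair_f`, **`localInvInfAt_H2π_eq_zero_iff_pull`**.
* §2 `exists_stabilizer_archPlaceEmb_eq` (`archPlaceEmb = ι_{E_{w_v}} ∘ g_{w_v}`, `g ∈ Stab(w_v)`), `archReadoutCorr`,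
  `galRestrictField_eq_conj`, `isLocallyConstant_galRestrictField`, **`archReadoutPair v ιE`** (the pair `(galRestrictField, π_v)`),
  **`localInvInfAt_archEmbPlace_H2π_eq_zero_iff_readout`**, **`localInvInf_H2π_eq_zero_iff_readout`** (door-c5's `localInvInf E v`).
* §3 `two_nsmul_localInvInf`, **`localInvInf_H2π_eq_of_iff`** (the value from any `2`-torsion reading),
  **`localInvInf_H2π_eq_zmodToQmodZ_canonical_of_iff`** (the value through `LocalInvariants.canonical F n (inl v)`).

HONEST FRAMING: classical class field theory bookkeeping (Tate 1967) in the tree's two dialects; proves no case of Poitou–Tate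
or BSD.  Route A of crux `AnticycControlAdditiveK` (item 19295, cell bsd-schneider), archimedean half (e) of the pairing step (R4):
with this file the E-side sum `inv E β = Σ_v localInv E v β + Σ_{v∣∞} localInvInf E v β` can be matched termwise with the local
Tate pairings at the INFINITE places too, so that hE is not restricted to totally complex base fields.

## References
* J. W. S. Cassels, A. Fröhlich (eds.), *Algebraic Number Theory* (1967), Ch. VII (Tate) §1.1, §7.2–§7.3 Cor. 7.4 (b), §11.2.
  [CasselsFrohlichANT1967]
* J. S. Milne, *Arithmetic Duality Theorems*, 2nd ed. (2006), Ch. I Ex. 1.6 (c), Lemma 4.13, Thm. 4.10. [MilneADT2006]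
* J.-P. Serre, *Local Fields*, GTM 67 (1979), Ch. VII §5 Prop. 3. [SerreLocalFields1979]
* J.-P. Serre, *Galois Cohomology* (1997), Ch. I §2.4–2.5. [SerreGaloisCohomology1997]
-/

noncomputable section

open NumberField NumberField.InfinitePlace IsDedekindDomain CategoryTheory groupCohomology Function Field
open Literature.NumberTheory.Automorphic
open scoped NumberField.LiesOver

namespace Literature.NumberTheory.GaloisRepresentations

namespace IdeleCohomology

open ArchHerbrand IdeleReadout Literature.Algebra.Homology DiscreteGaloisModule Literature.NumberTheory.GaloisCohomology
open Literature.AnabelianGeometry.AbsoluteAnabelian.Prop121vii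

-- As in `IdeleLocalInvariantReadout.lean`: the classes `twoCocycleClass` need `LocallyCompactSpace Γ_{F_v}`, whose only source for a
-- general field is this theorem; local, no override.
attribute [local instance] absoluteGaloisGroup_compactSpace

variable {F : Type} [Field F] [NumberField F] {E : Type} [Field E] [NumberField E] [Algebra F E] [IsGalois F E]

omit [IsGalois F E] [NumberField E] in
/-- `F_v` has characteristic `0`. [cite: CasselsFrohlichANT1967, Ch. II §10] -/
private theorem charZero_completion' (v : InfinitePlace F) : CharZero v.Completion :=
  charZero_of_injective_algebraMap (algebraMap F v.Completion).injective

/-! ## §1. Archimedean Shapiro on a general idèle class: `IsoAut ∘ Sh_{w₀} ∘ Hⁿ(π_{∞,v}) = Hⁿ(archDecompIncl w₀, x ↦ x_{∞,w₀})` -/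

section Shapiro

variable (v : InfinitePlace F) (w₀ : InfinitePlace E) [hL : w₀.1.LiesOver v.1]

/-- **`J_E → E_{w₀}ˣ`, `x ↦ x_{∞,w₀}`, as a morphism `Res_{archDecompIncl w₀} J_E ⟶ E_{w₀}ˣ`** of `Gal(E_{w₀}/F_v)`-modules
(`(g • x)_{w₀} = g_{w₀}(x_{w₀})` for `g ∈ Stab(w₀)`). [cite: CasselsFrohlichANT1967, Ch. VII §1.1, §7.2] -/
def archIdelePlaceRepHom :
    Rep.res (archDecompIncl v w₀) (IdeleClassGroup.ideleRep F E) ⟶ Rep.ofAlgebraAutOnUnits v.Completion w₀.Completion :=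
  Rep.ofHom ⟨(archProj (E := E) (w₀.comap (algebraMap F E)) w₀) ∘ₗ
      (infPlaceProj (F := F) (E := E) (w₀.comap (algebraMap F E))).hom.toLinearMap, fun g => by
    apply LinearMap.ext
    intro x
    refine Additive.toMul.injective (Units.ext ?_)
    change ((Additive.toMul (archProj (E := E) (w₀.comap (algebraMap F E)) w₀
        ((infPlaceProj (w₀.comap (algebraMap F E))).hom ((IdeleClassGroup.ideleRep F E).ρ (archDecompIncl v w₀ g) x))) :
          (w₀.Completion)ˣ) : w₀.Completion) =
      g ((Additive.toMul (archProj (E := E) (w₀.comap (algebraMap F E)) w₀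
        ((infPlaceProj (w₀.comap (algebraMap F E))).hom x)) : (w₀.Completion)ˣ) : w₀.Completion)
    rw [Rep.hom_comm_apply, archDecompIncl, MonoidHom.comp_apply, Subgroup.coe_subtype]
    refine (coe_toMul_archProj_ρ_of_smul_eq (K := F) (w₀.comap (algebraMap F E)) w₀ _
      (coe_stabilizer_smul w₀ ((archDecompMulEquiv v w₀).symm.toMonoidHom g))
      ((infPlaceProj (F := F) (E := E) (w₀.comap (algebraMap F E))).hom x)).trans ?_
    rw [← archDecompAlgEquiv_apply v w₀, ← archDecompMulEquiv_apply v w₀]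
    exact congrArg (fun e : w₀.Completion ≃ₐ[v.Completion] w₀.Completion => e _)
      ((archDecompMulEquiv v w₀).apply_symm_apply g)⟩

/-- Unfolding: `archIdelePlaceRepHom v w₀ x = (π_{∞,v} x)_{w₀}`. [cite: CasselsFrohlichANT1967, Ch. VII §7.2] -/
theorem archIdelePlaceRepHom_apply (x : Additive (ideleGroup E)) :
    (archIdelePlaceRepHom v w₀).hom x =
      archProj (E := E) (w₀.comap (algebraMap F E)) w₀ ((infPlaceProj (F := F) (w₀.comap (algebraMap F E))).hom x) := rfl

/-- **Door-c5's archimedean Shapiro isomorphism on a general idèle class is `Hⁿ(archDecompIncl w₀, x ↦ x_{∞,w₀})`**: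
`Hⁿ(π_{∞,v}) ≫ Sh_{w₀} ≫ IsoAut_{w₀} = Hⁿ(archDecompIncl w₀, archIdelePlaceRepHom w₀)` (`Sh_{w₀} = Hⁿ(Stab(w₀) ↪ G, π_{w₀})`,
`IsoAut = Hⁿ(archDecompMulEquiv⁻¹, id)`). [cite: CasselsFrohlichANT1967, Ch. VII §7.2] [cite: Brown1982CohomologyGroups, III (6.2)] -/
theorem shapiroArch_infPlaceProj [Fintype (E ≃ₐ[F] E)] (n : ℕ) :
    groupCohomology.map (MonoidHom.id _) (infPlaceProj (E := E) (w₀.comap (algebraMap F E))) n ≫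
        (groupCohomologyArchUnitsRepIso (F := F) w₀ n).hom ≫ (groupCohomologyArchLocalUnitsRepIsoAut v w₀ n).hom =
      groupCohomology.map (archDecompIncl v w₀) (archIdelePlaceRepHom v w₀) n := by
  rw [groupCohomologyArchUnitsRepIso_hom_eq, groupCohomologyArchLocalUnitsRepIsoAut, groupCohomology.mapIso_hom,
    ← Category.assoc, ← groupCohomology.map_comp, ← groupCohomology.map_comp]
  refine map_congr' (MonoidHom.ext fun _ => rfl) _ _ (fun x => ?_) n
  refine Additive.toMul.injective (Units.ext ?_)
  rfl

/-- Element form of `shapiroArch_infPlaceProj`. [cite: CasselsFrohlichANT1967, Ch. VII §7.2] -/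
theorem shapiroArch_infPlaceProj_apply [Fintype (E ≃ₐ[F] E)] (n : ℕ) (c : groupCohomology (IdeleClassGroup.ideleRep F E) n) :
    (groupCohomologyArchLocalUnitsRepIsoAut v w₀ n).hom ((groupCohomologyArchUnitsRepIso (F := F) w₀ n).hom
        (groupCohomology.map (MonoidHom.id (E ≃ₐ[F] E)) (infPlaceProj (E := E) (w₀.comap (algebraMap F E))) n c)) =
      groupCohomology.map (archDecompIncl v w₀) (archIdelePlaceRepHom v w₀) n c := by
  have h := congrArg (fun T => (ConcreteCategory.hom T) c) (shapiroArch_infPlaceProj v w₀ n)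
  simpa only [ModuleCat.hom_comp, LinearMap.coe_comp, Function.comp_apply] using h

/-- **The archimedean idèle pair at `w₀`**: `(Γ_{F_v}, F̄_vˣ) → (Gal(E/F), J_E)` through the completion `E_{w₀}`, module
component `x ↦ ι_{E_{w₀}}(x_{∞,w₀})` (`ι_{E_{w₀}} = embeddingToAbs F_v E_{w₀}`). [cite: SerreGaloisCohomology1997, Ch. I §2.4] -/
def archIdelePair : CompatiblePair (IdeleClassGroup.ideleRep F E) (units v.Completion).toTopRep :=
  haveI := charZero_completion' (F := F) v
  haveI := finiteDimensional_completion v w₀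
  haveI := isGalois_completion v w₀
  (absUnitsPair v.Completion w₀.Completion).compMap (archDecompIncl v w₀) (archIdelePlaceRepHom v w₀)

/-- The module component of `archIdelePair v w₀`: `x ↦ ι_{E_{w₀}}(x_{∞,w₀})`. [cite: SerreGaloisCohomology1997, Ch. I §2.4] -/
theorem archIdelePair_φ (x : Additive (ideleGroup E)) :
    (archIdelePair v w₀).φ x =
      (haveI := finiteDimensional_completion v w₀; UnitsCarrier.ofUnits
        (Units.map (embeddingToAbs v.Completion w₀.Completion : w₀.Completion →* AlgebraicClosure v.Completion)
          (Additive.toMul (archProj (E := E) (w₀.comap (algebraMap F E)) w₀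
            ((infPlaceProj (F := F) (w₀.comap (algebraMap F E))).hom x))))) := by
  haveI := charZero_completion' (F := F) v
  haveI := finiteDimensional_completion v w₀
  haveI := isGalois_completion v w₀
  change (absUnitsPair v.Completion w₀.Completion).φ ((archIdelePlaceRepHom v w₀).hom x) = _
  rw [archIdelePlaceRepHom_apply, ← ofMul_toMul (archProj (E := E) (w₀.comap (algebraMap F E)) w₀ _)]
  exact (absUnitsPair_φ_ofMul _ _ _).trans (congrArg UnitsCarrier.ofUnits (Units.ext rfl))

/-- The group component of `archIdelePair v w₀` acts on `E ⊆ E_{w₀}` as dictated by `ι_{E_{w₀}}`: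
`ι_{E_{w₀}}((f s) e) = s • ι_{E_{w₀}}(e)`. [cite: SerreGaloisCohomology1997, Ch. I §2.4] -/
theorem embeddingToAbs_archIdelePair_f (s : absoluteGaloisGroup v.Completion) (e : E) :
    (haveI := finiteDimensional_completion v w₀;
      embeddingToAbs v.Completion w₀.Completion (((archIdelePair v w₀).f s e : E) : w₀.Completion)) =
      s • (haveI := finiteDimensional_completion v w₀;
        embeddingToAbs v.Completion w₀.Completion (e : w₀.Completion)) := by
  haveI := charZero_completion' (F := F) v
  haveI := finiteDimensional_completion v w₀
  haveI := isGalois_completion v w₀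
  change embeddingToAbs v.Completion _ ((archDecompIncl v w₀ ((absUnitsPair v.Completion w₀.Completion).f s) e : E) :
    w₀.Completion) = _
  rw [coe_archDecompIncl_apply]
  exact CompatiblePair.apply_f_apply_eq_smul v.Completion (absUnitsPair v.Completion w₀.Completion) _
    (absUnitsPair_φ_ofMul _ _) s _

/-- **Door-c5's archimedean local invariant of a GENERAL idèle class vanishes iff the pulled-back cocycle is a continuous
coboundary**: `localInvInfAt w₀ [b] = 0 ↔ [pull_{archIdelePair w₀} b] = 0` in `H²(Γ_{F_v}, F̄_vˣ)` (the archimedean invariant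
`archLayerInv`, the Shapiro isomorphisms and `unitsAbsInfTwo F_v E_{w₀}` are injective).
[cite: CasselsFrohlichANT1967, Ch. VII §7.3 Cor. 7.4 (b)] [cite: SerreLocalFields1979, Ch. X §4 Prop. 6] -/
theorem localInvInfAt_H2π_eq_zero_iff_pull [Fintype (E ≃ₐ[F] E)] (b : cocycles₂ (IdeleClassGroup.ideleRep F E)) :
    localInvInfAt (F := F) w₀ (H2π _ b) = 0 ↔
      twoCocycleClass (units v.Completion).toTopRep ((archIdelePair v w₀).pull b) = 0 := by
  haveI := charZero_completion' (F := F) v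
  haveI := finiteDimensional_completion v w₀
  haveI := isGalois_completion v w₀
  have hSh := shapiroArch_infPlaceProj_apply v w₀ 2 (H2π _ b)
  have hkey : unitsAbsInfTwo v.Completion w₀.Completion
      ((groupCohomologyArchLocalUnitsRepIsoAut v w₀ 2).hom ((groupCohomologyArchUnitsRepIso (F := F) w₀ 2).hom
        (groupCohomology.map (MonoidHom.id (E ≃ₐ[F] E)) (infPlaceProj (E := E) (w₀.comap (algebraMap F E))) 2 (H2π _ b)))) =
      twoCocycleClass (units v.Completion).toTopRep ((archIdelePair v w₀).pull b) := by
    rw [hSh, H2π_comp_map_apply, unitsAbsInfTwo_H2π, CompatiblePair.pull_mapCocycles₂]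
    rfl
  rw [localInvInfAt_eq_zero_iff, ← hkey]
  constructor
  · intro h
    rw [h, map_zero, map_zero, map_zero]
    rfl
  · intro h
    have h1 := unitsAbsInfTwo_injective v.Completion w₀.Completion (h.trans (map_zero _).symm)
    have h2 := (groupCohomologyArchLocalUnitsRepIsoAut v w₀ 2).toLinearEquiv.injective (h1.trans (map_zero _).symm)
    exact (groupCohomologyArchUnitsRepIso (F := F) w₀ 2).toLinearEquiv.injective (h2.trans (map_zero _).symm)

end Shapiro

/-! ## §2. The archimedean readout pair `(s ↦ s|_E, π_v)` at the distinguished place `w_v` and the dictionary -/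

section Readout

variable (v : InfinitePlace F) (ιE : E →ₐ[F] AlgebraicClosure F)

/-- **The two `F_v`-embeddings of `E_{w_v}` into `F̄_v` differ by an element of the decomposition group**: there is
`g ∈ Stab(w_v)` with `archPlaceEmb y = ι_{E_{w_v}}(g_{w_v} y)` for all `y` (`E_{w_v}/F_v` is normal: `AlgHom.restrictNormal'`;
`Stab(w_v) ≃* Gal(E_{w_v}/F_v)`). [cite: SerreLocalFields1979, Ch. VII §5 Prop. 3] [cite: CasselsFrohlichANT1967, Ch. VII §1.1] -/
theorem exists_stabilizer_archPlaceEmb_eq :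
    ∃ g : MulAction.stabilizer (E ≃ₐ[F] E) (archEmbPlace v ιE),
      ∀ y : (archEmbPlace v ιE).Completion,
        archPlaceEmb v ιE y =
          (haveI := liesOver_archEmbPlace v ιE
           haveI := finiteDimensional_completion v (archEmbPlace v ιE)
           embeddingToAbs v.Completion (archEmbPlace v ιE).Completion (archDecompAlgEquiv v (archEmbPlace v ιE) g y)) := by
  haveI := liesOver_archEmbPlace v ιE
  haveI := charZero_completion' (F := F) v
  haveI := finiteDimensional_completion v (archEmbPlace v ιE)
  haveI := isGalois_completion v (archEmbPlace v ιE)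
  set L := (archEmbPlace v ιE).Completion
  let φ₀ : L →ₐ[v.Completion] AlgebraicClosure v.Completion := embeddingToAbs v.Completion L
  letI : Algebra L (AlgebraicClosure v.Completion) := φ₀.toRingHom.toAlgebra
  haveI : IsScalarTower v.Completion L (AlgebraicClosure v.Completion) :=
    IsScalarTower.of_algebraMap_eq fun x => (φ₀.commutes x).symm
  let τ : L ≃ₐ[v.Completion] L := (archPlaceEmbAlgHom v ιE).restrictNormal' L
  have hτ : ∀ y : L, φ₀ (τ y) = archPlaceEmb v ιE y := fun y => by
    have h := AlgHom.restrictNormal_commutes (archPlaceEmbAlgHom v ιE) L y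
    rw [Algebra.algebraMap_self, RingHom.id_apply] at h
    exact h
  refine ⟨(archDecompMulEquiv v (archEmbPlace v ιE)).symm τ, fun y => ?_⟩
  rw [← archDecompMulEquiv_apply, MulEquiv.apply_symm_apply]
  exact (hτ y).symm

/-- The correcting element `g ∈ Stab(w_v)` (`archPlaceEmb = ι_{E_{w_v}} ∘ g_{w_v}`). [cite: CasselsFrohlichANT1967, Ch. VII §1.1] -/
def archReadoutCorr : MulAction.stabilizer (E ≃ₐ[F] E) (archEmbPlace v ιE) :=
  Classical.choose (exists_stabilizer_archPlaceEmb_eq v ιE)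

/-- `archPlaceEmb y = ι_{E_{w_v}}(g_{w_v} y)`. [cite: CasselsFrohlichANT1967, Ch. VII §1.1] -/
theorem archPlaceEmb_eq_embeddingToAbs_archReadoutCorr (y : (archEmbPlace v ιE).Completion) :
    archPlaceEmb v ιE y =
      (haveI := liesOver_archEmbPlace v ιE
       haveI := finiteDimensional_completion v (archEmbPlace v ιE)
       embeddingToAbs v.Completion (archEmbPlace v ιE).Completion
          (archDecompAlgEquiv v (archEmbPlace v ιE) (archReadoutCorr v ιE) y)) :=
  Classical.choose_spec (exists_stabilizer_archPlaceEmb_eq v ιE) y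

/-- **The readout restriction is conjugate to the archimedean idèle pair's group component**:
`s|_E = g⁻¹ (archIdelePair w_v).f(s) g`. [cite: SerreLocalFields1979, Ch. VII §5 Prop. 3] -/
theorem galRestrictField_eq_conj (s : absoluteGaloisGroup v.Completion) :
    galRestrictField v.Completion ιE s =
      (archReadoutCorr v ιE : E ≃ₐ[F] E)⁻¹ *
        (haveI := liesOver_archEmbPlace v ιE; (archIdelePair v (archEmbPlace v ιE)).f s) *
          (archReadoutCorr v ιE : E ≃ₐ[F] E) := by
  haveI := liesOver_archEmbPlace v ιE
  haveI := finiteDimensional_completion v (archEmbPlace v ιE)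
  -- `g ∘ s|_E = f(s) ∘ g`, read through the injective `ι_{E_w} ∘ (E ⊆ E_w)`
  have h1 : ∀ e' : E, embeddingToAbs v.Completion (archEmbPlace v ιE).Completion
      ((((archReadoutCorr v ιE : E ≃ₐ[F] E) e' : E) : (archEmbPlace v ιE).Completion)) =
      archPlaceEmb v ιE (e' : (archEmbPlace v ιE).Completion) := fun e' => by
    rw [archPlaceEmb_eq_embeddingToAbs_archReadoutCorr, archDecompAlgEquiv_apply, galInfiniteCompletionMap_coe]
  have key : (archReadoutCorr v ιE : E ≃ₐ[F] E) * galRestrictField v.Completion ιE s =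
      (archIdelePair v (archEmbPlace v ιE)).f s * (archReadoutCorr v ιE : E ≃ₐ[F] E) := by
    refine AlgEquiv.ext fun e => ?_
    rw [AlgEquiv.mul_apply, AlgEquiv.mul_apply]
    have hinj : Function.Injective (((embeddingToAbs v.Completion (archEmbPlace v ιE).Completion) :
          (archEmbPlace v ιE).Completion →+* AlgebraicClosure v.Completion).comp
        (algebraMap E (archEmbPlace v ιE).Completion)) := RingHom.injective _
    apply hinj
    change embeddingToAbs v.Completion _
        ((((archReadoutCorr v ιE : E ≃ₐ[F] E) (galRestrictField v.Completion ιE s e) : E) :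
          (archEmbPlace v ιE).Completion)) =
      embeddingToAbs v.Completion _
        ((((archIdelePair v (archEmbPlace v ιE)).f s ((archReadoutCorr v ιE : E ≃ₐ[F] E) e) : E) :
          (archEmbPlace v ιE).Completion))
    rw [h1, embeddingToAbs_archIdelePair_f, h1, archPlaceEmb_coe, archPlaceEmb_coe, absClosureEmbedding_ιE_galRestrictField]
  rw [mul_assoc, ← key, ← mul_assoc, inv_mul_cancel, one_mul]

/-- `s ↦ s|_E` is locally constant on `Γ_{F_v}` (it is conjugate to the locally constant group component of
`archIdelePair w_v`). [cite: SerreGaloisCohomology1997, Ch. I §2.4] -/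
theorem isLocallyConstant_galRestrictField : IsLocallyConstant (galRestrictField v.Completion ιE) := by
  haveI := liesOver_archEmbPlace v ιE
  have h : (galRestrictField v.Completion ιE : absoluteGaloisGroup v.Completion → E ≃ₐ[F] E) =
      (fun x => (archReadoutCorr v ιE : E ≃ₐ[F] E)⁻¹ * x * (archReadoutCorr v ιE : E ≃ₐ[F] E)) ∘
        (archIdelePair v (archEmbPlace v ιE)).f := by
    funext s
    exact galRestrictField_eq_conj v ιE s
  rw [h]
  exact (archIdelePair v (archEmbPlace v ιE)).isLocallyConstant_f.comp _

/-- **The archimedean readout pair `(Γ_{F_v}, F̄_vˣ) → (Gal(E/F), J_E)`**: group component `s ↦ s|_E = galRestrictField F_v ιE s`,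
module component `π_v = ideleInfPlaceReadout v ιE` (compatible by `ideleInfPlaceReadout_smul`).
[cite: SerreGaloisCohomology1997, Ch. I §2.4] [cite: MilneADT2006, I Lemma 4.13 (proof)] -/
def archReadoutPair : CompatiblePair (IdeleClassGroup.ideleRep F E) (units v.Completion).toTopRep where
  f := galRestrictField v.Completion ιE
  isLocallyConstant_f := isLocallyConstant_galRestrictField v ιE
  φ := ideleInfPlaceReadout v ιE
  comm s a := by
    obtain ⟨x, rfl⟩ := (Additive.ofMul : ideleGroup E ≃ Additive (ideleGroup E)).surjective a
    exact ideleInfPlaceReadout_smul v ιE s x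

/-- The module component of the archimedean readout pair is `π_v`. [cite: MilneADT2006, I Lemma 4.13 (proof)] -/
@[simp] theorem archReadoutPair_φ (x : Additive (ideleGroup E)) :
    (archReadoutPair v ιE).φ x = ideleInfPlaceReadout v ιE x := rfl

/-- The group component of the archimedean readout pair is `galRestrictField`. [cite: SerreGaloisCohomology1997, Ch. I §2.4] -/
@[simp] theorem archReadoutPair_f (s : absoluteGaloisGroup v.Completion) :
    (archReadoutPair v ιE).f s = galRestrictField v.Completion ιE s := rfl

/-- **The readout pair is conjugate to the archimedean idèle pair at `w_v`: module components**
`π_v(x) = (archIdelePair w_v).φ (g • x)`. [cite: SerreLocalFields1979, Ch. VII §5 Prop. 3] -/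
theorem archReadoutPair_φ_eq_archIdelePair_φ_smul (x : Additive (ideleGroup E)) :
    (archReadoutPair v ιE).φ x =
      (haveI := liesOver_archEmbPlace v ιE;
        (archIdelePair v (archEmbPlace v ιE)).φ ((IdeleClassGroup.ideleRep F E).ρ (archReadoutCorr v ιE : E ≃ₐ[F] E) x)) := by
  haveI := liesOver_archEmbPlace v ιE
  haveI := finiteDimensional_completion v (archEmbPlace v ιE)
  rw [archReadoutPair_φ, archIdelePair_φ]
  apply unitsVal_injective
  apply Units.ext
  rw [unitsVal_ofUnits, Units.coe_map, MonoidHom.coe_coe, coe_unitsVal_ideleInfPlaceReadout,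
    archPlaceEmb_eq_embeddingToAbs_archReadoutCorr, archDecompAlgEquiv_apply, Rep.hom_comm_apply]
  congr 1
  refine Eq.trans ?_ (coe_toMul_archProj_ρ_of_smul_eq (K := F) ((archEmbPlace v ιE).comap (algebraMap F E))
    (archEmbPlace v ιE) (archReadoutCorr v ιE : E ≃ₐ[F] E) (coe_stabilizer_smul _ (archReadoutCorr v ιE))
    ((infPlaceProj (F := F) (E := E) ((archEmbPlace v ιE).comap (algebraMap F E))).hom x)).symm
  congr 1
  rw [coe_toMul_archProj]
  change _ = ((((cutoff E ((archEmbPlace v ιE).comap (algebraMap F E)) (IdeleHerbrand.infHom E (Additive.toMul x))) :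
    infUnits E ((archEmbPlace v ιE).comap (algebraMap F E))) : (InfiniteAdeleRing E)ˣ) : InfiniteAdeleRing E) (archEmbPlace v ιE)
  rw [coe_cutoff_apply_of_isOver _ (rfl : IsOver E ((archEmbPlace v ιE).comap (algebraMap F E)) (archEmbPlace v ιE))]
  rfl

/-- **F7-dict (ii) at an INFINITE place: the idèle local invariant at the distinguished place vanishes iff the class read out
through `π_v` vanishes**: `localInvInfAt w_v [b] = 0 ↔ [pull_{(s ↦ s|_E, π_v)} b] = 0` in `H²(Γ_{F_v}, F̄_vˣ)`, for every `2`-cocycle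
`b` of `Gal(E/F)` in `J_E`. [cite: CasselsFrohlichANT1967, Ch. VII §7.3 Cor. 7.4 (b), §11.2] [cite: SerreLocalFields1979, Ch. VII §5 Prop. 3] -/
theorem localInvInfAt_archEmbPlace_H2π_eq_zero_iff_readout [Fintype (E ≃ₐ[F] E)] (b : cocycles₂ (IdeleClassGroup.ideleRep F E)) :
    localInvInfAt (F := F) (archEmbPlace v ιE) (H2π _ b) = 0 ↔
      twoCocycleClass (units v.Completion).toTopRep ((archReadoutPair v ιE).pull b) = 0 := by
  haveI := liesOver_archEmbPlace v ιE
  rw [localInvInfAt_H2π_eq_zero_iff_pull v (archEmbPlace v ιE),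
    CompatiblePair.twoCocycleClass_pull_eq_of_conj (archIdelePair v (archEmbPlace v ιE)) (archReadoutPair v ιE)
      (archReadoutCorr v ιE : E ≃ₐ[F] E) (fun s => galRestrictField_eq_conj v ιE s)
      (fun a => archReadoutPair_φ_eq_archIdelePair_φ_smul v ιE a) b]

/-- **The same for door-c5's `localInvInf E v`** (read at the chosen place; the archimedean local invariant does not depend on the
place above `v`, `localInvInf_eq_localInvInfAt`). [cite: CasselsFrohlichANT1967, Ch. VII §7.3 Cor. 7.4 (b)] -/
theorem localInvInf_H2π_eq_zero_iff_readout [Fintype (E ≃ₐ[F] E)] (b : cocycles₂ (IdeleClassGroup.ideleRep F E)) :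
    localInvInf E v (H2π _ b) = 0 ↔ twoCocycleClass (units v.Completion).toTopRep ((archReadoutPair v ιE).pull b) = 0 := by
  rw [localInvInf_eq_localInvInfAt (isOver_archEmbPlace v ιE)]
  exact localInvInfAt_archEmbPlace_H2π_eq_zero_iff_readout v ιE b

end Readout

/-! ## §3. The value: `localInvInf E v c ∈ {0, ½}` is determined by its vanishing -/

section Value

variable (v : InfinitePlace F) (ιE : E →ₐ[F] AlgebraicClosure F)

omit [IsGalois F E] in
/-- **`2 • localInvInf E v c = 0`** (`n_v • inv_v = 0` with `n_v = #Stab(w) ∈ {1, 2}`).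
[cite: CasselsFrohlichANT1967, Ch. VII §7.3 Cor. 7.4 (b)] -/
theorem two_nsmul_localInvInf [IsGalois F E] (c : groupCohomology (IdeleClassGroup.ideleRep F E) 2) :
    2 • localInvInf E v c = 0 := by
  have h := infLocalDegree_nsmul_localInvInf (E := E) v c
  rcases infLocalDegree_eq_one_or_two (E := E) v with h1 | h2
  · rw [h1, one_smul] at h
    rw [h, smul_zero]
  · rwa [h2] at h

/-- **The archimedean local invariant of a general idèle class from ANY `2`-torsion reading of the readout class**: if
`t ∈ ℚ/ℤ` is `2`-torsion and vanishes exactly when `[pull_{archReadoutPair} b]` does, then `localInvInf E v [b] = t`.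
[cite: MilneADT2006, Ch. I, Ex. 1.6 (c)] [cite: CasselsFrohlichANT1967, Ch. VII §7.3 Cor. 7.4 (b)] -/
theorem localInvInf_H2π_eq_of_iff [Fintype (E ≃ₐ[F] E)] (b : cocycles₂ (IdeleClassGroup.ideleRep F E)) {t : AddCircle (1 : ℚ)}
    (ht : 2 • t = 0) (hiff : twoCocycleClass (units v.Completion).toTopRep ((archReadoutPair v ιE).pull b) = 0 ↔ t = 0) :
    localInvInf E v (H2π _ b) = t :=
  eq_of_two_nsmul_eq_zero_of_iff (two_nsmul_localInvInf v _) ht ((localInvInf_H2π_eq_zero_iff_readout v ιE b).trans hiff)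

/-- **The archimedean local invariant of a general idèle class through THE canonical family**: for every class
`x ∈ H²(Γ_{F_v}, μₙ|)` that vanishes exactly when `[pull_{archReadoutPair} b]` does,
`localInvInf E v [b] = zmodToQmodZ n (LocalInvariants.canonical F n (inl v) x)` (`canonical (inl v) = archimedeanInvariantMap`:
injective at a real `v`, zero at a complex `v`, `2`-torsion valued). [cite: MilneADT2006, Ch. I, Ex. 1.6 (c)]
[cite: CasselsFrohlichANT1967, Ch. VII §7.3 Cor. 7.4 (b), §11.2] -/
theorem localInvInf_H2π_eq_zmodToQmodZ_canonical_of_iff [Fintype (E ≃ₐ[F] E)] {n : ℕ} [NeZero n]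
    (b : cocycles₂ (IdeleClassGroup.ideleRep F E)) (x : galoisCohomology ((mu F n).toLocal (Sum.inl v)) 2)
    (hiff : v.IsReal → (twoCocycleClass (units v.Completion).toTopRep ((archReadoutPair v ιE).pull b) = 0 ↔ x = 0)) :
    localInvInf E v (H2π _ b) = zmodToQmodZ n (LocalInvariants.canonical F n (Sum.inl v) x) := by
  rcases v.isReal_or_isComplex with hvr | hvc
  swap
  · rw [localInvInf_eq_zero_of_isComplex hvc, LocalInvariants.canonical_inl_eq_zero_of_isComplex hvc, map_zero]
  refine localInvInf_H2π_eq_of_iff v ιE b ?_ ((hiff hvr).trans ?_)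
  · rw [← map_nsmul, LocalInvariants.canonical_inl, two_nsmul_archimedeanInvariantMap, map_zero]
  · rw [← map_zero (zmodToQmodZ n), (zmodToQmodZ_injective n).eq_iff, LocalInvariants.canonical_inl,
      ← map_zero (archimedeanInvariantMap F n v), (archimedeanInvariantMap_injective_of_isReal hvr).eq_iff]

end Value

end IdeleCohomology

end Literature.NumberTheory.GaloisRepresentations

end
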